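import Literature.AlgebraicGeometry.Resolution.CobordantBlowupFiltration
import Literature.AlgebraicGeometry.Resolution.MarkedIdeals
import Literature.AlgebraicGeometry.Resolution.AffineBlowupCartier
import Mathlib.AlgebraicGeometry.Sites.SmallAffineZariski
import Mathlib.AlgebraicGeometry.Morphisms.Affine
import HarnessLib

/-!
# Cobordant blow-ups (Włodarczyk 2022), V: the global cobordant blow-up `Spec_Y ⊕ₙ 𝒥ₙ tⁿ`

Topic: `Literature/AlgebraicGeometry/Resolution`. Continuation of `CobordantBlowupFiltration.lean`
(definition request `defn-CobordantBlowup`). The affine model `B = Spec A[t⁻¹, uᵢ t^{wᵢ}]`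
(`CobordantBlowup.lean`) only blows up centres presented by global functions on an affine
scheme; the route `ResolutionOfSingularities/WeightedInvariant` iterates cobordant blow-ups
(`Y ↦ B₊`, which is never affine), so it needs Włodarczyk's definition over a general scheme:

  J. Włodarczyk, arXiv:2203.03090, Def. 2.3.5: `B := Spec_X (𝒪_X[t⁻¹, t^{w₁} x₁, …, t^{w_k} x_k])`,
  the relative spectrum of the extended Rees algebra `𝒜_𝒥^ext` of the centre; App. Def. 5.1.1
  ("Cobordant blow-ups of Rees algebras"): for a Rees algebra `R = ⊕ R_a t^a ⊆ 𝒪_X[t]` on a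
  Noetherian scheme `X`, "the full cobordant blow-up of `R` is `B := Spec_X(R[t⁻¹]) → X`. We
  define the cobordant blow-up as the open subset `B₊ := B ∖ V(R₊)`" (the vertex `V(R)` being
  `V(⊕_{a>0} R_a)`, §2.2).

Here the Rees algebra is given by its graded pieces, a `ReesFiltration` — ideal sheaves
`𝒪_Y = 𝒥₀ ⊇ 𝒥₁ ⊇ ⋯` with `𝒥_m 𝒥_n ⊆ 𝒥_{m+n}` (Mathlib's `Scheme.IdealSheafData`); for a weighted
centre `𝒥ₙ = (u^α : Σ αᵢ wᵢ ≥ n)` locally (`weightedFiltration`, part IV). We build, by Mathlib's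
relative gluing of quasi-coherent `𝒪_Y`-algebras over the small affine Zariski site
(`Scheme.AffineZariskiSite.relativeGluingData`; quasi-coherence is
`IdealFiltration.isLocalization_away_extendedRees` of part IV):

* `ReesFiltration Y`, `ReesFiltration.sectionsRing R U = ⊕ₙ 𝒥ₙ(U) tⁿ ⊆ Γ(Y, U)[t, t⁻¹]` (`U`
  affine), the presheaf `ReesFiltration.diagram` with its structure map `diagramMap` and its
  quasi-coherence `coequifibered_diagramMap`;
* `ReesFiltration.cobordantBlowup R = Spec_Y ⊕ₙ 𝒥ₙ tⁿ` — **the full cobordant blow-up `B` of the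
  Rees algebra** (Def. 5.1.1 / Def. 2.3.5), with `π : B ⟶ Y` affine (`isAffineHom_π`), the open
  cover by the `Spec ⊕ₙ 𝒥ₙ(U) tⁿ` (`openCover`, `ι_π`, `π_preimage`);
* `ReesFiltration.toA1 : B ⟶ 𝔸¹ = Spec ℤ[x]`, `x ↦ t⁻¹` — the `𝔾_m`-semi-invariant coordinate
  `t⁻¹`, and **the exceptional ideal sheaf `exc = (t⁻¹)`** as the pull-back of `(x)`
  (Lemma 2.3.8: `D = V_B(t⁻¹)`);
* `ReesFiltration.plus R : B.Opens` — **`B₊ = B ∖ V(R₊)`**, the union over the affine charts of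
  the complements of the vertex `V(⊕_{n>0} 𝒥ₙ(U) tⁿ)`; `πPlus : B₊ ⟶ Y` — **the cobordant
  blow-up `σ₊`**; `excPlus` — the exceptional divisor on `B₊`;
* `ReesFiltration.strictTransform R K = ⋃ₙ (π^*K : (t⁻¹)ⁿ)` and `strictTransformPlus` — **the
  strict transform** of an ideal sheaf `K` of `Y` on `B` and on `B₊` (§3.3, the
  `t⁻¹`-saturation of the total transform, as in the affine model);
* `ReesFiltration.sectionsRing_eq_cobordantAlgebra` — over an affine open on which the
  filtration is the weighted filtration of `(u, w)`, the sections ring IS the affine model's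
  `cobordantAlgebra u w` (part IV, `cobordantAlgebra_eq_extendedRees`), so that the chart of `B`
  over `U` is `Spec (cobordantAlgebra u w)` (`chartIsoAffineModel`).

## Sources

* J. Włodarczyk, arXiv:2203.03090 (July 2025 version): Def. 2.3.5, Lemma 2.3.8 (PDF pp. 10–11),
  §2.2 (vertex of a Rees algebra), §3.3 (strict transforms), App. §5.1 Def. 5.1.1 (PDF p. 46).
  [Wlodarczyk2022]
* The Stacks Project, Tag 01LQ (relative spectrum of a quasi-coherent algebra) — through
  Mathlib's `relativeGluingData`. [StacksProject]
-/

noncomputable section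

open scoped LaurentPolynomial
open LaurentPolynomial CategoryTheory CategoryTheory.Limits AlgebraicGeometry TopologicalSpace

namespace Literature.AlgebraicGeometry.Resolution

universe u

variable {Y : Scheme.{u}}

/-- A **Rees filtration** on a scheme `Y`: ideal sheaves `𝒪_Y = 𝒥₀ ⊇ 𝒥₁ ⊇ 𝒥₂ ⊇ ⋯` with
`𝒥_m · 𝒥_n ⊆ 𝒥_{m+n}` — the graded pieces of a (rational, here integrally graded) Rees algebra
`R = ⊕ₙ 𝒥ₙ tⁿ ⊆ 𝒪_Y[t]` (Włodarczyk, §2.2; the Rees algebra `𝒜_𝒥 = ⊕ (𝒥^a)_Y t^a` of a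
weighted centre `𝒥`, §2.1.3 and Lemma 2.1.8, is the case `𝒥ₙ = (u^α : Σ αᵢ wᵢ ≥ n)` locally).
[cite: Wlodarczyk2022, §2.2] -/
structure ReesFiltration (Y : Scheme.{u}) where
  /-- the `n`-th piece `𝒥ₙ` -/
  ideal : ℕ → Y.IdealSheafData
  /-- `𝒥₀ = 𝒪_Y` -/
  ideal_zero : ideal 0 = ⊤
  /-- `𝒥₀ ⊇ 𝒥₁ ⊇ ⋯` -/
  antitone : Antitone ideal
  /-- `𝒥_m 𝒥_n ⊆ 𝒥_{m+n}` -/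
  mul_le : ∀ m n, ideal m * ideal n ≤ ideal (m + n)

namespace ReesFiltration

variable (R : ReesFiltration Y)

/-- The filtration of ideals `𝒥ₙ(U)` of `Γ(Y, U)` induced on an affine open `U`. [folklore] -/
def filtration (U : Y.affineOpens) : IdealFiltration Γ(Y, U) where
  ideal n := (R.ideal n).ideal U
  ideal_zero := by rw [R.ideal_zero]; rfl
  antitone _ _ h := Scheme.IdealSheafData.ideal_mono (R.antitone h) U
  mul_le m n := by
    have h := R.mul_le m n
    rw [Scheme.IdealSheafData.le_def] at h
    simpa only [Scheme.IdealSheafData.ideal_mul, Pi.mul_apply] using h U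

/-- Unfolding the pieces of the induced filtration. [folklore] -/
@[simp] theorem filtration_ideal (U : Y.affineOpens) (n : ℕ) :
    (R.filtration U).ideal n = (R.ideal n).ideal U := rfl

/-- **The Rees filtration `(𝒥ⁿ)ₙ` of powers of an ideal sheaf** — the Rees algebra
`𝒜_𝒥 = 𝒪_Y[𝒥 t] = ⊕ 𝒥ⁿ tⁿ` of an ordinary ideal (Włodarczyk, §2.2.1 "Examples": "the Rees algebra of
an ideal `ℐ` is the standard `ℤ`-graded algebra `𝒜_ℐ = ⊕ ℐⁿ tⁿ`, with extended version
`𝒜_ℐ^ext = 𝒪_X[t⁻¹, ℐ t]`"); its cobordant blow-up is the one at the centre `V(𝒥)` with all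
weights `1` (Lemma 4.6.1). [cite: Wlodarczyk2022, §2.2] -/
def powers (J : Y.IdealSheafData) : ReesFiltration Y where
  ideal n := J ^ n
  ideal_zero := by rw [pow_zero, Scheme.IdealSheafData.one_eq_top]
  antitone m n h U := by
    change (J ^ n).ideal U ≤ (J ^ m).ideal U
    rw [Scheme.IdealSheafData.ideal_pow, Scheme.IdealSheafData.ideal_pow, Pi.pow_apply, Pi.pow_apply]
    exact Ideal.pow_le_pow_right h
  mul_le m n := by rw [← pow_add]

/-- Unfolding the powers filtration. [folklore] -/
@[simp] theorem powers_ideal (J : Y.IdealSheafData) (n : ℕ) : (powers J).ideal n = J ^ n := rfl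

/-- The Rees filtration **is locally a weighted filtration**: near every point there are an
affine open `U`, sections `u₁, …, u_k ∈ Γ(Y, U)` and positive weights `w₁, …, w_k` with
`𝒥ₙ(U) = (u^α : Σ αᵢ wᵢ ≥ n)` for all `n` — the shape of the Rees algebra
`𝒜_𝒥 = ⊕ₙ (u^α : Σ αᵢwᵢ ≥ n) tⁿ` of a weighted centre `𝒥 = (u₁^{1/w₁}, …, u_k^{1/w_k})` (Włodarczyk,
Lemma 2.1.8/2.1.9; a *regular* weighted centre, §2.1.7, asks moreover that the `uᵢ` be part of a
regular system of parameters on a regular `Y`, which is not part of this predicate).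
[cite: Wlodarczyk2022, Lemma 2.1.8] -/
def IsLocallyWeighted (R : ReesFiltration Y) : Prop :=
  ∀ y : Y, ∃ U : Y.affineOpens, y ∈ (U : Y.Opens) ∧ ∃ (k : ℕ) (u : Fin k → Γ(Y, U)) (w : Fin k → ℕ),
    (∀ i, 0 < w i) ∧ ∀ n, (R.ideal n).ideal U = Ideal.span (weightedMonomials u w n)

/-- **The sections `Γ(B, π⁻¹U) = ⊕ₙ 𝒥ₙ(U) tⁿ ⊆ Γ(Y, U)[t, t⁻¹]` of the full cobordant blow-up
over an affine open `U`**: the extended Rees algebra of the induced filtration (Włodarczyk,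
Def. 5.1.1: `R[t⁻¹]`; Def. 2.3.5: `𝒪_X[t⁻¹, t^{wᵢ} xᵢ]`). [cite: Wlodarczyk2022, Def. 5.1.1] -/
abbrev sectionsRing (U : Y.affineOpens) : Subalgebra Γ(Y, U) (Γ(Y, U))[T;T⁻¹] :=
  (R.filtration U).extendedRees

/-- Restriction of Laurent polynomials along `V ⊆ U`. [folklore] -/
def resL {U V : Y.Opens} (h : V ≤ U) : (Γ(Y, U))[T;T⁻¹] →+* (Γ(Y, V))[T;T⁻¹] :=
  AddMonoidAlgebra.mapRingHom ℤ (Y.presheaf.map (homOfLE h).op).hom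

/-- Restriction maps `⊕ 𝒥ₙ(U) tⁿ` into `⊕ 𝒥ₙ(V) tⁿ`. [folklore] -/
theorem resL_mem {U V : Y.affineOpens} (h : (V : Y.Opens) ≤ U) {p : (Γ(Y, U))[T;T⁻¹]}
    (hp : p ∈ R.sectionsRing U) : resL h p ∈ R.sectionsRing V := by
  rw [IdealFiltration.mem_extendedRees_iff] at hp ⊢
  intro n
  rw [resL, AddMonoidAlgebra.coeff_mapRingHom]
  exact Ideal.mem_comap.mp ((R.ideal n).ideal_le_comap_ideal (U := V) (V := U) h (hp n))

open Scheme.AffineZariskiSite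

/-- **The presheaf `U ↦ ⊕ₙ 𝒥ₙ(U) tⁿ`** on the small affine Zariski site of `Y` (the
quasi-coherent `𝒪_Y`-algebra `R[t⁻¹]`, Włodarczyk Def. 5.1.1). [cite: Wlodarczyk2022, Def. 5.1.1] -/
def diagram : Y.AffineZariskiSiteᵒᵖ ⥤ CommRingCat.{u} where
  obj U := CommRingCat.of (R.sectionsRing ⟨U.unop.1, U.unop.2⟩)
  map {U V} i := CommRingCat.ofHom ((resL (toOpens_mono i.unop.le)).restrict
      (R.sectionsRing ⟨U.unop.1, U.unop.2⟩) (R.sectionsRing ⟨V.unop.1, V.unop.2⟩)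
      fun _ hp => R.resL_mem (U := ⟨U.unop.1, U.unop.2⟩) (V := ⟨V.unop.1, V.unop.2⟩) _ hp)
  map_id U := by
    refine CommRingCat.hom_ext (RingHom.ext fun x => Subtype.ext ?_)
    obtain ⟨p, hp⟩ := x
    rw [CommRingCat.hom_ofHom, RingHom.coe_restrict_apply, CommRingCat.hom_id, RingHom.id_apply]
    have : (homOfLE (toOpens_mono (𝟙 U).unop.le)).op = 𝟙 _ := Subsingleton.elim _ _
    rw [resL, this, Y.presheaf.map_id, CommRingCat.hom_id, AddMonoidAlgebra.mapRingHom_id]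
    rfl
  map_comp {U V W} i j := by
    refine CommRingCat.hom_ext (RingHom.ext fun x => Subtype.ext ?_)
    obtain ⟨p, hp⟩ := x
    rw [CommRingCat.hom_ofHom, RingHom.coe_restrict_apply, CommRingCat.hom_comp, RingHom.comp_apply,
      CommRingCat.hom_ofHom, CommRingCat.hom_ofHom, RingHom.coe_restrict_apply,
      RingHom.coe_restrict_apply, resL, resL, resL, ← RingHom.comp_apply (AddMonoidAlgebra.mapRingHom ℤ _),
      ← AddMonoidAlgebra.mapRingHom_comp, ← CommRingCat.hom_comp, ← Y.presheaf.map_comp]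
    exact congrArg (fun φ ↦ AddMonoidAlgebra.mapRingHom ℤ (Y.presheaf.map φ).hom p)
      (Subsingleton.elim _ _)

/-- Restriction fixes constants: `resL (a t⁰) = (a|_V) t⁰`. [folklore] -/
theorem resL_C {U V : Y.Opens} (h : V ≤ U) (a : Γ(Y, U)) :
    resL h (C a) = C ((Y.presheaf.map (homOfLE h).op).hom a) := by
  rw [resL, ← single_eq_C, AddMonoidAlgebra.mapRingHom_single, single_eq_C]

/-- Restriction fixes `tⁿ`. [folklore] -/
theorem resL_T {U V : Y.Opens} (h : V ≤ U) (n : ℤ) : resL h (T n : (Γ(Y, U))[T;T⁻¹]) = T n := by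
  rw [resL, T, AddMonoidAlgebra.mapRingHom_single, map_one]
  rfl

/-- The structure map `𝒪_Y ⟶ ⊕ₙ 𝒥ₙ tⁿ`, `a ↦ a t⁰`. [folklore] -/
def diagramMap : (toOpensFunctor Y).op ⋙ Y.presheaf ⟶ R.diagram where
  app U := CommRingCat.ofHom (algebraMap Γ(Y, U.unop.1) (R.sectionsRing ⟨U.unop.1, U.unop.2⟩))
  naturality {U V} i := by
    refine CommRingCat.hom_ext (RingHom.ext fun a => Subtype.ext ?_)
    exact ((congrArg (fun φ ↦ C ((Y.presheaf.map φ).hom a)) (Subsingleton.elim _ _)).trans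
      (resL_C (toOpens_mono i.unop.le) a).symm :
        C ((Y.presheaf.map ((toOpensFunctor Y).map i.unop).op).hom a) =
          resL (toOpens_mono i.unop.le) (C a))

/-- **Quasi-coherence of `⊕ₙ 𝒥ₙ tⁿ`**: over `D(f) ⊆ U`, `⊕ 𝒥ₙ(D(f)) tⁿ` is the localization of
`⊕ 𝒥ₙ(U) tⁿ` at `f` (`IdealFiltration.isLocalization_away_extendedRees`, using
`𝒥ₙ(D(f)) = 𝒥ₙ(U) Γ(D(f))` for ideal sheaves), in Mathlib's form `NatTrans.Coequifibered`.
[folklore] -/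
theorem coequifibered_diagramMap : R.diagramMap.Coequifibered := by
  refine coequifibered_iff_forall_isLocalizationAway.mpr fun U f => ?_
  dsimp only [diagram, diagramMap]
  letI alg : Algebra Γ(Y, U.1) Γ(Y, Y.basicOpen f) :=
    (Y.presheaf.map (homOfLE (Y.basicOpen_le f)).op).hom.toAlgebra
  haveI : IsLocalization.Away f Γ(Y, Y.basicOpen f) := U.2.isLocalization_basicOpen f
  have heq : ∀ n, (R.filtration ⟨Y.basicOpen f, U.2.basicOpen f⟩).ideal n =
      ((R.filtration ⟨U.1, U.2⟩).ideal n).map (algebraMap Γ(Y, U.1) Γ(Y, Y.basicOpen f)) :=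
    fun n => ((R.ideal n).map_ideal_basicOpen ⟨U.1, U.2⟩ f).symm
  exact (R.filtration ⟨U.1, U.2⟩).isLocalization_away_extendedRees
    (R.filtration ⟨Y.basicOpen f, U.2.basicOpen f⟩) f heq

/-- The relative gluing datum of the quasi-coherent `𝒪_Y`-algebra `⊕ₙ 𝒥ₙ tⁿ` (Mathlib
`relativeGluingData`). [folklore] -/
def glueData : (directedCover Y).RelativeGluingData :=
  relativeGluingData R.coequifibered_diagramMap

/-- The gluing diagram `U ↦ Spec ⊕ 𝒥ₙ(U) tⁿ` is locally directed (Mathlib, relative gluing).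
[folklore] -/
instance isLocallyDirected_glueData_functor :
    (R.glueData.functor ⋙ Scheme.forget).IsLocallyDirected :=
  Scheme.Cover.RelativeGluingData.instIsLocallyDirectedI₀CompFunctorForgetOfIsThin ..

/-- **The full cobordant blow-up `B = Spec_Y ⊕ₙ 𝒥ₙ tⁿ`** of the Rees filtration `(𝒥ₙ)`
(Włodarczyk, App. Def. 5.1.1: "`B := Spec_X(R[t⁻¹]) → X`"; for the weighted filtration of a
weighted centre this is Def. 2.3.5, `B = Spec_X 𝒪_X[t⁻¹, t^{w₁} x₁, …, t^{w_k} x_k]`), glued from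
the `Spec ⊕ 𝒥ₙ(U) tⁿ` over the affine opens `U`. [cite: Wlodarczyk2022, Def. 5.1.1] -/
def cobordantBlowup : Scheme.{u} := R.glueData.glued

/-- The open cover of `B` by the charts `Spec ⊕ 𝒥ₙ(U) tⁿ`, `U ⊆ Y` affine open. [folklore] -/
def openCover : R.cobordantBlowup.OpenCover := R.glueData.cover

/-- **The projection `π : B ⟶ Y`** (`σ` in Włodarczyk, Def. 2.3.5). [cite: Wlodarczyk2022, Def. 2.3.5] -/
def π : R.cobordantBlowup ⟶ Y := R.glueData.toBase

/-- On the chart over an affine `U`, `π` is `Spec` of `Γ(Y, U) → ⊕ 𝒥ₙ(U) tⁿ` followed by `U ↪ Y`.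
[folklore] -/
@[reassoc]
theorem ι_π (U : Y.AffineZariskiSite) :
    R.openCover.f U ≫ R.π = Spec.map (R.diagramMap.app (.op U)) ≫ U.2.fromSpec :=
  colimit.ι_desc _ _

/-- The chart over an affine `U` is exactly `π⁻¹ U`. [folklore] -/
theorem π_preimage (U : Y.AffineZariskiSite) :
    R.π ⁻¹ᵁ U.1 = (R.openCover.f U).opensRange := by
  simpa using! R.glueData.toBase_preimage_eq_opensRange_ι U

set_option backward.isDefEq.respectTransparency false in
/-- **`π : B ⟶ Y` is an affine morphism** (`B = Spec_Y` of a quasi-coherent algebra).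
[cite: Wlodarczyk2022, Def. 5.1.1] -/
instance isAffineHom_π : IsAffineHom R.π := by
  rw [IsZariskiLocalAtTarget.iff_of_iSup_eq_top (P := @IsAffineHom) _
    (iSup_affineOpens_eq_top _)]
  intro U
  let e := IsOpenImmersion.isoOfRangeEq (R.π ⁻¹ᵁ U).ι (R.openCover.f U)
      (by simpa using congr($(R.π_preimage U).1))
  rw [← MorphismProperty.cancel_left_of_respectsIso @IsAffineHom e.inv,
    ← MorphismProperty.cancel_right_of_respectsIso @IsAffineHom _ U.2.isoSpec.hom]
  have : IsAffineHom (Spec.map (R.diagramMap.app (.op U))) := inferInstance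
  convert! this
  rw [← cancel_mono U.2.fromSpec]
  simp [IsAffineOpen.isoSpec_hom, e, ι_π]


/-! ## The coordinate `t⁻¹ : B ⟶ 𝔸¹` and the exceptional ideal sheaf `(t⁻¹)` -/

/-- The base ring `ℤ`, lifted to the universe of the schemes. [folklore] -/
abbrev ZZ : Type u := ULift.{u} ℤ

/-- `ℤ[x] → ⊕ 𝒥ₙ(U) tⁿ`, `x ↦ t⁻¹`: the coordinate `t⁻¹` on the chart over `U`. [folklore] -/
def polyToSections (U : Y.affineOpens) : Polynomial ZZ.{u} →+* R.sectionsRing U :=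
  Polynomial.eval₂RingHom ((Int.castRingHom _).comp ULift.ringEquiv.toRingHom)
    ⟨T (-1), (R.filtration U).T_neg_one_mem_extendedRees⟩

/-- `x ↦ t⁻¹`. [folklore] -/
@[simp] theorem polyToSections_X (U : Y.affineOpens) :
    R.polyToSections U Polynomial.X = ⟨T (-1), (R.filtration U).T_neg_one_mem_extendedRees⟩ := by
  simp [polyToSections]

/-- Ring maps out of `ℤ` (in any universe) are unique. [folklore] -/
theorem ringHom_ZZ_ext {S : Type*} [NonAssocRing S] (f g : ZZ.{u} →+* S) : f = g := by
  refine RingHom.ext fun n => ?_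
  have hn : n = ((ULift.down n : ℤ) : ZZ.{u}) := by
    apply ULift.ext
    simp
  rw [hn, map_intCast, map_intCast]

/-- The coordinate `t⁻¹` is compatible with restriction of charts. [folklore] -/
theorem diagram_map_comp_polyToSections {U V : Y.AffineZariskiSiteᵒᵖ} (i : U ⟶ V) :
    (R.diagram.map i).hom.comp (R.polyToSections ⟨U.unop.1, U.unop.2⟩) =
      R.polyToSections ⟨V.unop.1, V.unop.2⟩ := by
  refine Polynomial.ringHom_ext' (ringHom_ZZ_ext _ _) ?_
  change (R.diagram.map i).hom (R.polyToSections _ Polynomial.X) = R.polyToSections _ Polynomial.X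
  simp only [polyToSections_X]
  apply Subtype.ext
  exact resL_T (toOpens_mono i.unop.le) (-1)

/-- The cocone `Spec ⊕ 𝒥ₙ(U) tⁿ ⟶ 𝔸¹ = Spec ℤ[x]`, `x ↦ t⁻¹`, over the gluing diagram. [folklore] -/
def toA1Cocone : Cocone R.glueData.functor where
  pt := Spec (.of (Polynomial ZZ.{u}))
  ι :=
    { app := fun U => Spec.map (CommRingCat.ofHom (R.polyToSections ⟨U.1, U.2⟩))
      naturality := fun {W U} i => by
        simp only [Functor.const_obj_map]
        change Spec.map (R.diagram.map i.op) ≫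
          Spec.map (CommRingCat.ofHom (R.polyToSections ⟨U.1, U.2⟩)) =
            Spec.map (CommRingCat.ofHom (R.polyToSections ⟨W.1, W.2⟩)) ≫ 𝟙 _
        rw [Category.comp_id, ← Spec.map_comp]
        congr 1
        ext : 1
        exact R.diagram_map_comp_polyToSections i.op }

/-- **The coordinate `t⁻¹ : B ⟶ 𝔸¹`**: the regular function `t⁻¹ = s` on the full cobordant
blow-up (an eigenfunction of weight `−1` for the torus), glued from `x ↦ t⁻¹` on the charts;
`B₋ = B ∖ V(t⁻¹)` is the preimage of `𝔸¹ ∖ 0` and the exceptional divisor is `V(t⁻¹)`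
(Włodarczyk, Def. 2.3.5 and Lemma 2.3.8). [cite: Wlodarczyk2022, Def. 2.3.5] -/
def toA1 : R.cobordantBlowup ⟶ Spec (.of (Polynomial ZZ.{u})) :=
  colimit.desc _ R.toA1Cocone

/-- On the chart over `U`, `t⁻¹` is `Spec` of `x ↦ t⁻¹`. [folklore] -/
@[reassoc]
theorem ι_toA1 (U : Y.AffineZariskiSite) :
    R.openCover.f U ≫ R.toA1 = Spec.map (CommRingCat.ofHom (R.polyToSections ⟨U.1, U.2⟩)) :=
  colimit.ι_desc _ _

/-- **The exceptional ideal sheaf `(t⁻¹)` on `B`**: the inverse image of the ideal sheaf `(x)` of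
the origin of `𝔸¹` under `t⁻¹ : B ⟶ 𝔸¹`; its zero locus is `Vert(B) ∪ D` and its restriction
to `B₊` is the exceptional divisor `D = V_B(t⁻¹)` (Włodarczyk, Lemma 2.3.8).
[cite: Wlodarczyk2022, Lemma 2.3.8] -/
def exc : R.cobordantBlowup.IdealSheafData :=
  (affineBlowup.idealSheaf (Ideal.span {(Polynomial.X : Polynomial ZZ.{u})})).comap R.toA1

/-- **`B₋ = B ∖ V(t⁻¹)`**, the trivial cobordant blow-up `Y × 𝔾_m` (Włodarczyk, Def. 2.3.5), as
the open preimage of `𝔸¹ ∖ 0`. [cite: Wlodarczyk2022, Def. 2.3.5] -/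
def minus : R.cobordantBlowup.Opens :=
  R.toA1 ⁻¹ᵁ PrimeSpectrum.basicOpen (Polynomial.X : Polynomial ZZ.{u})

/-! ## `B₊ = B ∖ V(R₊)` and the cobordant blow-up `σ₊ : B₊ ⟶ Y` -/

/-- **The irrelevant ideal `R₊ R[t⁻¹] = (⊕_{n > 0} Jₙ tⁿ)`** of the extended Rees algebra, whose
zero locus is the vertex (Włodarczyk, §2.2: "the vertex of `R` (or `R^ext`) is
`V(R) = V(Σ_{a>0} R_a)`"; Def. 2.3.5: `Vert(B) = V(t^{w₁} x₁, …, t^{w_k} x_k)`).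
[cite: Wlodarczyk2022, §2.2] -/
def _root_.Literature.AlgebraicGeometry.Resolution.IdealFiltration.irrelevant {A : Type u}
    [CommRing A] (F : IdealFiltration A) : Ideal F.extendedRees :=
  Ideal.span {p | ∃ (n : ℕ) (a : A), 0 < n ∧ a ∈ F.ideal n ∧ (p : A[T;T⁻¹]) = C a * T (n : ℤ)}

/-- On the chart `Spec ⊕ 𝒥ₙ(U) tⁿ`: the complement of the vertex `V(⊕_{n>0} 𝒥ₙ(U) tⁿ)`.
[cite: Wlodarczyk2022, Def. 5.1.1] -/
def plusChart (U : Y.affineOpens) : (Spec (CommRingCat.of (R.sectionsRing U))).Opens :=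
  ⟨(PrimeSpectrum.zeroLocus ((R.filtration U).irrelevant : Set (R.sectionsRing U)))ᶜ,
    (PrimeSpectrum.isClosed_zeroLocus _).isOpen_compl⟩

/-- `p` lies in the chart of `B₊` iff the irrelevant ideal is not contained in `p`. [folklore] -/
theorem mem_plusChart_iff (U : Y.affineOpens) (p : Spec (CommRingCat.of (R.sectionsRing U))) :
    p ∈ R.plusChart U ↔ ¬ (R.filtration U).irrelevant ≤ p.asIdeal :=
  Iff.rfl

/-- **`B₊ = B ∖ V(R₊)`** (Włodarczyk, App. Def. 5.1.1: "we define the cobordant blow-up as the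
open subset `B₊ := B ∖ V(R₊)`"; Def. 2.3.5: `B₊ = B ∖ V(t^{w₁} x₁, …, t^{w_k} x_k)`): the union
over the affine charts of the complements of the vertex. [cite: Wlodarczyk2022, Def. 5.1.1] -/
def plus : R.cobordantBlowup.Opens :=
  ⨆ U : Y.AffineZariskiSite, (R.openCover.f U) ''ᵁ (R.plusChart ⟨U.1, U.2⟩)

/-- Each chart's complement of the vertex lies in `B₊`. [folklore] -/
theorem image_plusChart_le_plus (U : Y.AffineZariskiSite) :
    (R.openCover.f U) ''ᵁ (R.plusChart ⟨U.1, U.2⟩) ≤ R.plus :=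
  le_iSup (fun U : Y.AffineZariskiSite => (R.openCover.f U) ''ᵁ (R.plusChart ⟨U.1, U.2⟩)) U

/-- **The cobordant blow-up `σ₊ : B₊ ⟶ Y`** of the Rees filtration (Włodarczyk, Def. 2.3.5 /
Def. 5.1.1), `B₊` as an open subscheme of `B`. [cite: Wlodarczyk2022, Def. 2.3.5] -/
def πPlus : (R.plus : Scheme.{u}) ⟶ Y :=
  R.plus.ι ≫ R.π

/-- **The exceptional divisor `D = V(t⁻¹) ∩ B₊`** of `σ₊`, as an ideal sheaf on `B₊`
(Włodarczyk, Lemma 2.3.8). [cite: Wlodarczyk2022, Lemma 2.3.8] -/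
def excPlus : (R.plus : Scheme.{u}).IdealSheafData :=
  R.exc.comap R.plus.ι

/-! ## Strict transforms -/

/-- **The strict transform `σˢ(K)` on `B`** of an ideal sheaf `K` of `Y` under the full cobordant
blow-up (Włodarczyk, §3.3: the schematic closure of `(𝒪_B · K)|_{B₋}`, i.e.
`σˢ(K) = {tᵃ f | f ∈ 𝒪_B · K, a ≥ 0}`): the `(t⁻¹)`-saturation `⋃ₙ (π^*K : (t⁻¹)ⁿ)` of the
total transform (colon ideal sheaves of `MarkedIdeals.lean`), as in the affine model
`cobordantBlowup.strictTransform`. [cite: Wlodarczyk2022, §3.3] -/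
def strictTransform (K : Y.IdealSheafData) : R.cobordantBlowup.IdealSheafData :=
  ⨆ n : ℕ, colon (K.comap R.π) (R.exc ^ n)

/-- **The strict transform on `B₊`** of an ideal sheaf `K` of `Y` under `σ₊ : B₊ ⟶ Y`; the
strict transform of the closed subscheme `X = V(K) ⊆ Y` is `X' = V(σˢ(K)|_{B₊}) ⊆ B₊`
(Włodarczyk, §3.3 and the Remark following it). [cite: Wlodarczyk2022, §3.3] -/
def strictTransformPlus (K : Y.IdealSheafData) : (R.plus : Scheme.{u}).IdealSheafData :=
  (R.strictTransform K).comap R.plus.ι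

/-- The total transform is contained in the strict transform. [folklore] -/
theorem comap_le_strictTransform (K : Y.IdealSheafData) :
    K.comap R.π ≤ R.strictTransform K := by
  refine le_trans ?_ (le_iSup (fun n : ℕ => colon (K.comap R.π) (R.exc ^ n)) 0)
  rw [pow_zero, Scheme.IdealSheafData.one_eq_top, colon_top]

/-! ## Comparison with the affine model -/

/-- Two filtrations with the same pieces are equal. [folklore] -/
theorem _root_.Literature.AlgebraicGeometry.Resolution.IdealFiltration.ext' {A : Type u} [CommRing A]
    {F G : IdealFiltration A} (h : ∀ n, F.ideal n = G.ideal n) : F = G := by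
  obtain ⟨f, _, _, _⟩ := F
  obtain ⟨g, _, _, _⟩ := G
  obtain rfl : f = g := funext h
  rfl

variable {ι : Type u}

/-- If on the affine open `U` the pieces `𝒥ₙ(U)` are the weighted monomial ideals of `(u, w)`,
the induced filtration is the weighted filtration. [folklore] -/
theorem filtration_eq_weightedFiltration (U : Y.affineOpens) (u : ι → Γ(Y, U)) (w : ι → ℕ)
    (h : ∀ n, (R.ideal n).ideal U = Ideal.span (weightedMonomials u w n)) :
    R.filtration U = weightedFiltration u w :=
  IdealFiltration.ext' fun n => h n

/-- **The chart of the global construction is the affine model**: if over the affine open `U`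
the Rees filtration is the weighted filtration of `(u, w)` (a presentation of the weighted
centre by `uᵢ ∈ Γ(Y, U)` with weights `wᵢ`), then `Γ(B, π⁻¹U) = ⊕ 𝒥ₙ(U) tⁿ` is Włodarczyk's
`Γ(Y, U)[t⁻¹, uᵢ t^{wᵢ}]` (`cobordantAlgebra u w`, by `cobordantAlgebra_eq_extendedRees`).
[cite: Wlodarczyk2022, Def. 2.3.5] -/
theorem sectionsRing_eq_cobordantAlgebra (U : Y.affineOpens) (u : ι → Γ(Y, U)) (w : ι → ℕ)
    (h : ∀ n, (R.ideal n).ideal U = Ideal.span (weightedMonomials u w n)) :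
    R.sectionsRing U = cobordantAlgebra u w := by
  rw [show R.sectionsRing U = (R.filtration U).extendedRees from rfl,
    R.filtration_eq_weightedFiltration U u w h, cobordantAlgebra_eq_extendedRees]

/-- The chart `Spec ⊕ 𝒥ₙ(U) tⁿ` of `B` over such a `U` is (isomorphic to) the affine model
`cobordantBlowup u w = Spec (cobordantAlgebra u w)` of `CobordantBlowup.lean`. [folklore] -/
def chartIsoAffineModel (U : Y.affineOpens) (u : ι → Γ(Y, U)) (w : ι → ℕ)
    (h : ∀ n, (R.ideal n).ideal U = Ideal.span (weightedMonomials u w n)) :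
    Spec (CommRingCat.of (R.sectionsRing U)) ≅ Spec (CommRingCat.of (cobordantAlgebra u w)) :=
  Scheme.Spec.mapIso (Subalgebra.equivOfEq _ _
    (R.sectionsRing_eq_cobordantAlgebra U u w h)).toRingEquiv.toCommRingCatIso.symm.op

end ReesFiltration

end Literature.AlgebraicGeometry.Resolution
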